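import Summits.CriticalPhenomena.Ising3DConformalLimit.Theses.HyperoctahedralRP
import Summits.CriticalPhenomena.Ising3DConformalLimit.Theses.IsingEuclidUpgrade
import Summits.CriticalPhenomena.Ising3DConformalLimit.Theses.ArmHyperscaling
import Summits.CriticalPhenomena.Ising3DConformalLimit.Theses.WeylWindow
import Summits.CriticalPhenomena.Ising3DConformalLimit.Theorems.LeeYangGapGaussianLimitKillsBlockCoupling
import Summits.CriticalPhenomena.Ising3DConformalLimit.Theorems.PerfectScreeningCoulombImpliesNontrivialBlockFieldDomination
import Summits.CriticalPhenomena.Ising3DConformalLimit.Theorems.ArmHyperscalingMergingFloorLeeYangDeficit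
import Summits.CriticalPhenomena.Ising3DConformalLimit.Theorems.ArmHyperscalingMergingFloorOneArmGivesMatchedIsotherm
import Literature.Probability.LatticeModels.PointwiseScalingLimitScaleCovariant
import Literature.Probability.LatticeModels.HighDimPointwiseTriviality
import Literature.Probability.LatticeModels.CriticalTwoPointLower
import Literature.Probability.LatticeModels.CriticalUrsellFourSign
import Literature.Barriers.CriticalPhenomena.IsingTrivialityFromDimensionFourProofs
import HarnessLib

/-!
# Glue of line `one-arm-isotherm-lattice`: `MergingFloor` ⇐ `OneArmHyperscaling` ∧ `LimitExists`

Crux stmt-CriticalPhenomena-15592 (`ArmHyperscaling.MergingFloor`, route ArmHyperscaling, Ising3DConformalLimit),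
line lead prover-line-stmt-CriticalPhenomena-15592-0, 2026-08-17. With the two provable stubs of the line LANDED —
S2 `stub_leeYangDeficit` (`ArmHyperscalingMergingFloorLeeYangDeficit.lean`) and S4 `stub_oneArmGivesMatchedIsotherm`
(`ArmHyperscalingMergingFloorOneArmGivesMatchedIsotherm.lean`) — the composition of the registered skeleton
`Cruxes/MergingFloor/Lines/one_arm_isotherm_lattice.lean` becomes a chain of unconditional implications between
route decls, recorded here so that the crux is KERNEL-REDUCED to existing open items BY NAME:

* `eventually_binder_ge_of_matchedIsotherm` — a matched upper critical isotherm at the CLT field scale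
  (`(2L+1)³ m(β_c, C/√Σ_L) ≤ ½ β_c C √Σ_L` eventually) forces the block Binder floor `g_L ≥ 1/(2β_c²C²)`
  eventually (S2 + the landed GKS block-field domination + `binder_lower_of_saturation`);
* `nonGaussian_of_matchedUpperIsotherm` — the matched upper isotherm for every non-degenerate scale-covariant
  limit implies item stmt-CriticalPhenomena-0636 `IsingEuclidUpgrade.IsingEuclidUpgradeR4NonGaussian` (with the
  landed `gaussianLimitKillsBlockCoupling_proof`, item 4950): the 0636 line `isotherm-saturation-lee-yang` modulo
  its one open stub S1;
* `nonGaussian_of_oneArmHyperscaling` — **PAYER EDGE item 15591 ⟹ item 0636**: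
  `ArmHyperscaling.OneArmHyperscaling → IsingEuclidUpgrade.IsingEuclidUpgradeR4NonGaussian` (by S4), and its
  `HyperoctahedralRP` copy;
* `mergingFloor_of_limit` — the LIMIT → LATTICE descent (ADC21 (3.11) bookkeeping): a non-degenerate full-filter
  pointwise limit with `U₄ ≢ 0` gives the lattice merging floor at the quadruple where `U₄^S < 0`;
* `mergingFloor_of_limitExists_of_nonGaussian` — `WeylWindow.LimitExists → IsingEuclidUpgradeR4NonGaussian →
  MergingFloor` (crux 15592 ⇐ items 4738 ∧ 0636: the `limit-descent` line);
* `mergingFloor_of_oneArmHyperscaling_of_limitExists` — **the registered glue stub**: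
  `OneArmHyperscaling → WeylWindow.LimitExists → MergingFloor` (crux 15592 ⇐ items 15591 ∧ 4738);
* `mergingFloor_of_oneArmHyperscaling_of_existsScaleCovariantLimit` — on route ArmHyperscaling the existence input
  is the route's own crux 1981: `OneArmHyperscaling → ExistsScaleCovariantLimit → MergingFloor`, i.e. the crux
  `MergingFloor` is implied by the route's cruxes #2 and #4.

No new mathematics beyond the skeleton's kernel-checked composition (strategist planner-cstrat-stmt-CriticalPhenomena-15592-b1-0)
with S2/S4 discharged. [cite: AizenmanDuminilCopinAnnals2021, eq. (3.11)] [cite: Newman1975, Thm 3]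
[cite: CamiaGarbanNewman2016, Thm 1.2]
-/

noncomputable section

namespace Summit.CriticalPhenomena.Ising3DConformalLimit.ArmHyperscalingMergingFloor

open Literature.Probability.LatticeModels Filter Set Finset
open scoped Topology BigOperators
open Summit.CriticalPhenomena.Ising3DConformalLimit.Theses

/-! ### Matched isotherm ⇒ Binder floor ⇒ non-Gaussian limit -/

/-- The real arithmetic at one block: deficit + domination + matched isotherm give the Binder floor.
With `Sg = Σ_L > 0`, `t = β C/√Sg`, `K = 3Σ_L² - ⟨M_L⁴⟩`, `Z = ⟨e^{tM}⟩ > 0`: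
`(Sg t - t³K) Z ≤ T ≤ Nm Z` and `Nm ≤ β C/2 · √Sg` force `1/(2β²C²) ≤ K/Sg²`. [folklore] -/
theorem binder_lower_of_saturation {β C Sg K Z T Nm : ℝ} (hβ : 0 < β) (hC : 0 < C) (hSg : 0 < Sg)
    (hZ : 0 < Z)
    (hdef : (Sg * (β * (C / Real.sqrt Sg)) - (β * (C / Real.sqrt Sg)) ^ 3 * K) * Z ≤ T)
    (hdom : T ≤ Nm * Z) (hiso : Nm ≤ β * C / 2 * Real.sqrt Sg) :
    1 / (2 * β ^ 2 * C ^ 2) ≤ K / Sg ^ 2 := by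
  set s : ℝ := Real.sqrt Sg with hs
  have hs0 : 0 < s := Real.sqrt_pos.2 hSg
  have hs2 : s ^ 2 = Sg := Real.sq_sqrt hSg.le
  set t : ℝ := β * (C / s) with ht
  have ht0 : 0 < t := by positivity
  -- cancel `Z`
  have h1 : Sg * t - t ^ 3 * K ≤ Nm := le_of_mul_le_mul_right (hdef.trans hdom) hZ
  -- `Nm ≤ t Sg / 2`
  have h2 : β * C / 2 * s = t * Sg / 2 := by
    rw [ht, ← hs2]; field_simp
  have h3 : Sg * t - t ^ 3 * K ≤ t * Sg / 2 := h1.trans (hiso.trans_eq h2)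
  -- hence `Sg / 2 ≤ t² K`
  have h4 : t * (Sg / 2) ≤ t * (t ^ 2 * K) := by nlinarith
  have h5 : Sg / 2 ≤ t ^ 2 * K := le_of_mul_le_mul_left h4 ht0
  -- `t² Sg = β² C²`
  have h6 : t ^ 2 * Sg = β ^ 2 * C ^ 2 := by
    rw [ht, ← hs2]; field_simp
  have hSg2 : 0 < Sg ^ 2 := by positivity
  rw [div_le_div_iff₀ (by positivity) hSg2]
  calc 1 * Sg ^ 2 = 2 * (Sg / 2) * Sg := by ring
    _ ≤ 2 * (t ^ 2 * K) * Sg := by gcongr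
    _ = K * (2 * (t ^ 2 * Sg)) := by ring
    _ = K * (2 * β ^ 2 * C ^ 2) := by rw [h6]; ring

/-- **Matched saturation forces a Binder floor**: if, for some `C > 0`, eventually in `L`
`(2L+1)³ · m(β_c, C/√Σ_L) ≤ ½ β_c C √Σ_L`, then eventually `1/(2β_c²C²) ≤ g_L := (3Σ_L² − ⟨M_L⁴⟩)/Σ_L²`
(Lee–Yang deficit S2 `stub_leeYangDeficit` + GKS block-field domination `stub_blockFieldDomination` +
`binder_lower_of_saturation`). [cite: Newman1975, Thm 3] -/
theorem eventually_binder_ge_of_matchedIsotherm {C : ℝ} (hC : 0 < C)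
    (hev : ∀ᶠ L : ℕ in atTop,
        (2 * (L : ℝ) + 1) ^ 3 * magnetizationInField 3 (criticalBeta 3)
            (C / Real.sqrt (plusExpect 3 (criticalBeta 3) 0 (fun σ => (∑ x ∈ box 3 L, spinAt x σ) ^ 2))) ≤
          criticalBeta 3 * C / 2 *
            Real.sqrt (plusExpect 3 (criticalBeta 3) 0 (fun σ => (∑ x ∈ box 3 L, spinAt x σ) ^ 2))) :
    ∀ᶠ L : ℕ in atTop,
      1 / (2 * criticalBeta 3 ^ 2 * C ^ 2) ≤
        (3 * (plusExpect 3 (criticalBeta 3) 0 (fun σ => (∑ x ∈ box 3 L, spinAt x σ) ^ 2)) ^ 2 -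
              plusExpect 3 (criticalBeta 3) 0 (fun σ => (∑ x ∈ box 3 L, spinAt x σ) ^ 4)) /
            (plusExpect 3 (criticalBeta 3) 0 (fun σ => (∑ x ∈ box 3 L, spinAt x σ) ^ 2)) ^ 2 := by
  have hβ : 0 < criticalBeta 3 := criticalBeta_pos_holds (d := 3) (by norm_num)
  filter_upwards [hev] with L hL
  set Sg : ℝ := plusExpect 3 (criticalBeta 3) 0 (fun σ => (∑ x ∈ box 3 L, spinAt x σ) ^ 2) with hSgdef
  have hSg : 0 < Sg := by
    simpa [hSgdef, Literature.Barriers.CriticalPhenomena.blockVariance,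
      Literature.Barriers.CriticalPhenomena.blockSpin] using
      Literature.Barriers.CriticalPhenomena.blockVariance_pos (d := 3) (criticalBeta_nonneg 3) L
  set h : ℝ := C / Real.sqrt Sg with hh
  have hh0 : 0 ≤ h := by positivity
  -- domination at field `h` (tilt `β_c h`)
  have hdom := Summit.CriticalPhenomena.Ising3DConformalLimit.PerfectScreeningCoulombImpliesNontrivial.stub_blockFieldDomination
    L h hh0
  -- deficit at tilt `t = β_c h`
  obtain ⟨hZ, hdefL⟩ := stub_leeYangDeficit L (criticalBeta 3 * h) (by positivity)
  have key := binder_lower_of_saturation (β := criticalBeta 3) (C := C) (Sg := Sg)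
    (K := 3 * Sg ^ 2 - plusExpect 3 (criticalBeta 3) 0 (fun σ => (∑ x ∈ box 3 L, spinAt x σ) ^ 4))
    hβ hC hSg hZ (by simpa [hh, mul_assoc] using hdefL) hdom (by simpa [hh] using hL)
  simpa [hSgdef] using key

/-- Normalisation glue: every non-degenerate pointwise limit has a normalisation `S'` (zero off
`NonCoincident`) that is again a non-degenerate pointwise limit with the same `ρ`, is scale covariant with
the automatic dimension, and whose `U₄`-non-triviality implies that of `S`. [folklore] -/
theorem exists_normalised {ρ : ℝ → ℝ} {S : CorrFamily 3}
    (hρ : ∀ δ ∈ Set.Ioc (0:ℝ) 1, 0 < ρ δ) (hlim : HasPointwiseScalingLimit (criticalCorr 3) ρ S)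
    (hnd : IsNondegenerateTwoPoint S) :
    ∃ (Δ : ℝ) (S' : CorrFamily 3), HasPointwiseScalingLimit (criticalCorr 3) ρ S' ∧
      IsNondegenerateTwoPoint S' ∧ IsScaleCovariant Δ S' ∧ (HasNontrivialU4 S' → HasNontrivialU4 S) := by
  classical
  set S' : CorrFamily 3 := fun n z => if Function.Injective z then S n z else 0 with hS'
  have S'_inj : ∀ {n : ℕ} {z : Fin n → EuclideanSpace ℝ (Fin 3)}, Function.Injective z →
      S' n z = S n z := fun hz => by simp only [hS', if_pos hz]
  have S'_ninj : ∀ {n : ℕ} {z : Fin n → EuclideanSpace ℝ (Fin 3)}, ¬ Function.Injective z →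
      S' n z = 0 := fun hz => by simp only [hS', if_neg hz]
  have hlim' : HasPointwiseScalingLimit (criticalCorr 3) ρ S' :=
    fun n => (hlim n).congr_right fun z hz => (S'_inj hz).symm
  have hnd' : IsNondegenerateTwoPoint S' := fun z hz => by rw [S'_inj hz]; exact hnd z hz
  obtain ⟨Δ, -, hcov⟩ := hlim'.exists_rpow_scale_mem_Icc hρ hnd'
  have hsc' : IsScaleCovariant Δ S' := by
    intro n c hc z
    by_cases hz : Function.Injective z
    · exact hcov n c hc z hz
    · have hz' : ¬ Function.Injective (fun i => c • z i) := fun h =>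
        hz ((smul_right_injective (EuclideanSpace ℝ (Fin 3)) hc.ne').of_comp_iff z |>.1 h)
      rw [S'_ninj hz', S'_ninj hz, mul_zero]
  refine ⟨Δ, S', hlim', hnd', hsc', ?_⟩
  rintro ⟨x, hx, hne⟩
  refine ⟨x, hx, ?_⟩
  have hinj : Function.Injective x := hx
  have hpair : ∀ i j : Fin 4, i ≠ j → S' 2 ![x i, x j] = S 2 ![x i, x j] := by
    intro i j hij
    exact S'_inj (pair_mem_nonCoincident (d := 3) fun h => hij (hinj h))
  have h4 : S' 4 x = S 4 x := S'_inj hinj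
  simp only [limitConnectedFour] at hne ⊢
  rwa [h4, hpair 0 1 (by decide), hpair 2 3 (by decide), hpair 0 2 (by decide), hpair 1 3 (by decide),
    hpair 0 3 (by decide), hpair 1 2 (by decide)] at hne

/-- **Matched upper critical isotherm ⇒ clause (iii).** If every non-degenerate scale-covariant pointwise
limit admits a matched upper critical isotherm, then every non-degenerate pointwise limit of `criticalCorr 3`
has `U₄ ≢ 0` — item stmt-CriticalPhenomena-0636 `IsingEuclidUpgrade.IsingEuclidUpgradeR4NonGaussian`, by name
(normalise `S`; a Gaussian limit kills the block coupling, `gaussianLimitKillsBlockCoupling_proof`, against the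
Binder floor). This is line `isotherm-saturation-lee-yang` of crux 0636 modulo its open stub S1. [folklore] -/
theorem nonGaussian_of_matchedUpperIsotherm
    (hiso : ∀ (ρ : ℝ → ℝ) (Δ : ℝ) (S : CorrFamily 3), (∀ δ ∈ Set.Ioc (0:ℝ) 1, 0 < ρ δ) →
      HasPointwiseScalingLimit (criticalCorr 3) ρ S → IsNondegenerateTwoPoint S →
      IsScaleCovariant Δ S →
      ∃ C : ℝ, 0 < C ∧ ∀ᶠ L : ℕ in atTop,
        (2 * (L : ℝ) + 1) ^ 3 * magnetizationInField 3 (criticalBeta 3)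
            (C / Real.sqrt (plusExpect 3 (criticalBeta 3) 0 (fun σ => (∑ x ∈ box 3 L, spinAt x σ) ^ 2))) ≤
          criticalBeta 3 * C / 2 *
            Real.sqrt (plusExpect 3 (criticalBeta 3) 0 (fun σ => (∑ x ∈ box 3 L, spinAt x σ) ^ 2))) :
    IsingEuclidUpgrade.IsingEuclidUpgradeR4NonGaussian := by
  intro ρ S hρ hlim hnd
  obtain ⟨Δ, S', hlim', hnd', hsc', hback⟩ := exists_normalised hρ hlim hnd
  refine hback ?_
  by_contra hU4
  have htend := Summit.CriticalPhenomena.Ising3DConformalLimit.LeeYangGapGaussianLimitKillsBlockCoupling.gaussianLimitKillsBlockCoupling_proof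
    ρ Δ S' hρ hlim' hnd' hsc' hU4
  obtain ⟨C, hC, hev⟩ := hiso ρ Δ S' hρ hlim' hnd' hsc'
  have hc : (0 : ℝ) < 1 / (2 * criticalBeta 3 ^ 2 * C ^ 2) := by
    have hβ : 0 < criticalBeta 3 := criticalBeta_pos_holds (d := 3) (by norm_num)
    positivity
  have hlow := eventually_binder_ge_of_matchedIsotherm hC hev
  have hup := htend.eventually (gt_mem_nhds hc)
  obtain ⟨L, h1, h2⟩ := (hlow.and hup).exists
  exact absurd h1 (not_le.2 h2)

/-- **PAYER EDGE item stmt-CriticalPhenomena-15591 ⟹ item stmt-CriticalPhenomena-0636.** One-arm hyperscaling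
on `ℤ³` at `β_c` implies that every non-degenerate pointwise scaling limit of the critical Ising₃ correlators has a
non-trivial connected four-point function: `ArmHyperscaling.OneArmHyperscaling →
IsingEuclidUpgrade.IsingEuclidUpgradeR4NonGaussian` (S4 `stub_oneArmGivesMatchedIsotherm` then
`nonGaussian_of_matchedUpperIsotherm`). [cite: CamiaGarbanNewman2016, Thm 1.2] -/
theorem nonGaussian_of_oneArmHyperscaling (hOA : ArmHyperscaling.OneArmHyperscaling) :
    IsingEuclidUpgrade.IsingEuclidUpgradeR4NonGaussian :=
  nonGaussian_of_matchedUpperIsotherm (stub_oneArmGivesMatchedIsotherm hOA)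

/-- The same payer edge into the `HyperoctahedralRP` copy of the shared decl of item 0636. [folklore] -/
theorem hyperoctahedralRP_nonGaussian_of_oneArmHyperscaling (hOA : ArmHyperscaling.OneArmHyperscaling) :
    HyperoctahedralRP.IsingEuclidUpgradeR4NonGaussian :=
  nonGaussian_of_oneArmHyperscaling hOA

/-! ### The limit → lattice descent and the compositions concluding the crux by name -/

/-- Renormalised pair correlators of a pointwise limit converge at pairs of distinct points of a non-coincident
quadruple. [folklore] -/
theorem tendsto_pair {ρ : ℝ → ℝ} {S : CorrFamily 3} (hlim : HasPointwiseScalingLimit (criticalCorr 3) ρ S)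
    {x : Fin 4 → EuclideanSpace ℝ (Fin 3)} (hx : x ∈ NonCoincident 3 4) {i j : Fin 4} (hij : i ≠ j) :
    Tendsto (fun δ => ρ δ ^ 2 * criticalCorr 3 2 ![latticeApprox δ (x i), latticeApprox δ (x j)])
      (𝓝[>] 0) (𝓝 (S 2 ![x i, x j])) := by
  have hinj : Function.Injective x := hx
  have hmem : (![x i, x j] : Fin 2 → EuclideanSpace ℝ (Fin 3)) ∈ NonCoincident 3 2 :=
    pair_mem_nonCoincident fun h => hij (hinj h)
  refine Tendsto.congr (fun δ => ?_) ((hlim 2).tendsto_at hmem)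
  rw [rescaledCorrelator_apply, latticeApprox_comp_two]
  rfl

/-- **LIMIT → LATTICE DESCENT**: a non-degenerate full-filter pointwise limit with `HasNontrivialU4` gives the lattice
merging floor (the crux's statement, unfolded) at the quadruple where `U₄^S < 0`, constant `−U₄^S(x)/(2S₂S₂)`. [cite: AizenmanDuminilCopinAnnals2021, eq. (3.11)] -/
theorem mergingFloor_of_limit {ρ : ℝ → ℝ} {S : CorrFamily 3}
    (hρ : ∀ δ ∈ Set.Ioc (0:ℝ) 1, 0 < ρ δ) (hlim : HasPointwiseScalingLimit (criticalCorr 3) ρ S)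
    (hnd : IsNondegenerateTwoPoint S) (hU4 : HasNontrivialU4 S) :
    ∃ x ∈ NonCoincident 3 4, ∃ c : ℝ, 0 < c ∧ ∀ᶠ δ in 𝓝[>] (0:ℝ),
      c * (criticalCorr 3 2 ![latticeApprox δ (x 0), latticeApprox δ (x 1)] *
          criticalCorr 3 2 ![latticeApprox δ (x 2), latticeApprox δ (x 3)]) ≤
        -(criticalCorr 3 4 (fun i => latticeApprox δ (x i)) -
          (criticalCorr 3 2 ![latticeApprox δ (x 0), latticeApprox δ (x 1)] *
              criticalCorr 3 2 ![latticeApprox δ (x 2), latticeApprox δ (x 3)]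
            + criticalCorr 3 2 ![latticeApprox δ (x 0), latticeApprox δ (x 2)] *
              criticalCorr 3 2 ![latticeApprox δ (x 1), latticeApprox δ (x 3)]
            + criticalCorr 3 2 ![latticeApprox δ (x 0), latticeApprox δ (x 3)] *
              criticalCorr 3 2 ![latticeApprox δ (x 1), latticeApprox δ (x 2)])) := by
  obtain ⟨x, hx, hneg⟩ :=
    (hasNontrivialU4_iff_exists_neg_of_hasPointwiseScalingLimit (d := 3) le_rfl hlim).1 hU4
  have hinj : Function.Injective x := hx
  set u : ℝ := - limitConnectedFour S x with hu
  set s : ℝ := S 2 ![x 0, x 1] * S 2 ![x 2, x 3] with hs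
  have hu0 : 0 < u := by rw [hu]; linarith
  have h01 : (![x 0, x 1] : Fin 2 → EuclideanSpace ℝ (Fin 3)) ∈ NonCoincident 3 2 :=
    pair_mem_nonCoincident fun h => absurd (hinj h) (by decide)
  have h23 : (![x 2, x 3] : Fin 2 → EuclideanSpace ℝ (Fin 3)) ∈ NonCoincident 3 2 :=
    pair_mem_nonCoincident fun h => absurd (hinj h) (by decide)
  have hs0 : 0 < s := mul_pos (hnd _ h01) (hnd _ h23)
  refine ⟨x, hx, u / (2 * s), by positivity, ?_⟩
  have hU : Tendsto (fun δ => -(ρ δ ^ 4 * (criticalCorr 3 4 (fun i => latticeApprox δ (x i)) -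
      (criticalCorr 3 2 ![latticeApprox δ (x 0), latticeApprox δ (x 1)] *
          criticalCorr 3 2 ![latticeApprox δ (x 2), latticeApprox δ (x 3)]
        + criticalCorr 3 2 ![latticeApprox δ (x 0), latticeApprox δ (x 2)] *
          criticalCorr 3 2 ![latticeApprox δ (x 1), latticeApprox δ (x 3)]
        + criticalCorr 3 2 ![latticeApprox δ (x 0), latticeApprox δ (x 3)] *
          criticalCorr 3 2 ![latticeApprox δ (x 1), latticeApprox δ (x 2)])))) (𝓝[>] 0) (𝓝 u) :=
    (tendsto_rescaled_criticalUrsellFour hlim hx).neg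
  have hB : Tendsto (fun δ => u / (2 * s) * ((ρ δ ^ 2 *
      criticalCorr 3 2 ![latticeApprox δ (x 0), latticeApprox δ (x 1)]) * (ρ δ ^ 2 *
      criticalCorr 3 2 ![latticeApprox δ (x 2), latticeApprox δ (x 3)]))) (𝓝[>] 0)
      (𝓝 (u / (2 * s) * s)) :=
    ((tendsto_pair hlim hx (i := 0) (j := 1) (by decide)).mul
      (tendsto_pair hlim hx (i := 2) (j := 3) (by decide))).const_mul _
  have hmid : u / (2 * s) * s < 3 * u / 4 := by
    rw [div_mul_eq_mul_div, mul_comm 2 s, ← div_div, mul_div_assoc, div_self hs0.ne', mul_one]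
    linarith
  have hmid' : 3 * u / 4 < u := by linarith
  have hIoc : Set.Ioc (0:ℝ) 1 ∈ 𝓝[>] (0:ℝ) := Ioc_mem_nhdsGT one_pos
  filter_upwards [hB.eventually_lt_const hmid, hU.eventually_const_lt hmid',
    Filter.eventually_of_mem hIoc fun δ hδ => hδ] with δ h1 h2 hδ
  have hρ4 : 0 < ρ δ ^ 4 := pow_pos (hρ δ hδ) 4
  have key : ρ δ ^ 4 * (u / (2 * s) *
      (criticalCorr 3 2 ![latticeApprox δ (x 0), latticeApprox δ (x 1)] *
        criticalCorr 3 2 ![latticeApprox δ (x 2), latticeApprox δ (x 3)])) ≤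
      ρ δ ^ 4 * (-(criticalCorr 3 4 (fun i => latticeApprox δ (x i)) -
      (criticalCorr 3 2 ![latticeApprox δ (x 0), latticeApprox δ (x 1)] *
          criticalCorr 3 2 ![latticeApprox δ (x 2), latticeApprox δ (x 3)]
        + criticalCorr 3 2 ![latticeApprox δ (x 0), latticeApprox δ (x 2)] *
          criticalCorr 3 2 ![latticeApprox δ (x 1), latticeApprox δ (x 3)]
        + criticalCorr 3 2 ![latticeApprox δ (x 0), latticeApprox δ (x 3)] *
          criticalCorr 3 2 ![latticeApprox δ (x 1), latticeApprox δ (x 2)]))) := by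
    have e1 : ρ δ ^ 4 * (u / (2 * s) *
        (criticalCorr 3 2 ![latticeApprox δ (x 0), latticeApprox δ (x 1)] *
          criticalCorr 3 2 ![latticeApprox δ (x 2), latticeApprox δ (x 3)])) =
        u / (2 * s) * ((ρ δ ^ 2 * criticalCorr 3 2 ![latticeApprox δ (x 0), latticeApprox δ (x 1)]) *
          (ρ δ ^ 2 * criticalCorr 3 2 ![latticeApprox δ (x 2), latticeApprox δ (x 3)])) := by ring
    rw [e1]
    linarith
  exact le_of_mul_le_mul_left key hρ4

/-- **Crux 15592 ⇐ items 4738 ∧ 0636** (line `limit-descent`): bare existence of a non-degenerate full-filter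
pointwise limit and limit-level non-Gaussianity give the lattice merging floor. [folklore] -/
theorem mergingFloor_of_limitExists_of_nonGaussian (hE : WeylWindow.LimitExists)
    (h36 : IsingEuclidUpgrade.IsingEuclidUpgradeR4NonGaussian) : ArmHyperscaling.MergingFloor := by
  obtain ⟨ρ, S, hρ, hlim, hnd⟩ := hE
  exact mergingFloor_of_limit hρ hlim hnd (h36 ρ S hρ hlim hnd)

/-- **REGISTERED GLUE STUB — crux 15592 ⇐ items 15591 ∧ 4738**: one-arm hyperscaling and bare existence of a
non-degenerate full-filter pointwise limit give `MergingFloor` (payer edge to 0636, then the descent). [folklore] -/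
theorem mergingFloor_of_oneArmHyperscaling_of_limitExists : Summit.CriticalPhenomena.Ising3DConformalLimit.Theses.ArmHyperscaling.OneArmHyperscaling → Summit.CriticalPhenomena.Ising3DConformalLimit.Theses.WeylWindow.LimitExists → Summit.CriticalPhenomena.Ising3DConformalLimit.Theses.ArmHyperscaling.MergingFloor :=
  fun hOA hE => mergingFloor_of_limitExists_of_nonGaussian hE (nonGaussian_of_oneArmHyperscaling hOA)

/-- **On route ArmHyperscaling the crux `MergingFloor` (#3) follows from the cruxes `OneArmHyperscaling` (#2) and
`ExistsScaleCovariantLimit` (#4, item 1981)** — the existence input of the descent is the route's own crux, by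
forgetting normalisation, translation invariance and scale covariance. [folklore] -/
theorem mergingFloor_of_oneArmHyperscaling_of_existsScaleCovariantLimit
    (hOA : ArmHyperscaling.OneArmHyperscaling) (hE : ArmHyperscaling.ExistsScaleCovariantLimit) :
    ArmHyperscaling.MergingFloor := by
  obtain ⟨ρ, Δ, S, hρ, -, hlim, -, hnd, -, -⟩ := hE
  exact mergingFloor_of_oneArmHyperscaling_of_limitExists hOA ⟨ρ, S, hρ, hlim, hnd⟩

end Summit.CriticalPhenomena.Ising3DConformalLimit.ArmHyperscalingMergingFloor

end
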